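import Summits.BirchSwinnertonDyer.BirchSwinnertonDyer.Theorems.ErratumRoadFiveSigmaLocalGoodFrobenius
import HarnessLib

/-!
# (S5) at the GOOD places: `charpoly Lt = X² − (a_w/q_w)X + 1/q_w` for the dual Frobenius on
# `H¹(I_w, E[p^∞])^∨ ⧸ tors`, from an evaluation isomorphism `H¹(I_w, E[p^∞]) ≃ E[p^∞]` (theorems only)

Cell `bsd-stepL`, K2 route `ErratumRoadFive`, support item 20495 `JSWSigmaLocalCharIdeal`
(`JetchevSkinnerWan2017.sigmaLocal_charIdeal_eulerFactor_mem_of_noTamagawaDefect`), step (S5) of the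
L5 plan (`HOME/imc-p1/g13/L5-PLAN`) at the finitely decomposed places of GOOD reduction; seat
`bsd-stepL-imc-p1` (g14). THEOREMS ONLY (no definition, no named fact, no `sorry`).

The atom is `sigmaLocal_of_eulerFactor_mem_span_intrinsic hS5` (p574664) and `hS5` at a good place asks
`eulerFactor p ℤ_[p] Nw (.good a) c ∈ ((charpoly Lt).reverse((1+T)^{−c}))`, `Lt` the dual of the
conjugation action `φ·` on `H¹(I_w, E[p^∞])`. Here:

* `charpoly_tateModule_conjMap_eq_of_equiv` — for ANY `ℤ_p`-linear bijection
  `e : H¹(I_w, E[p^∞]) ≃ E[p^∞]` with `q_w • e(φ·x) = ρ(φ)(e x)` (any place):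
  `charpoly T_p(φ·) = charpoly (q_w⁻¹ • ρ_{E,p}(res φ) | T_p E)` (transport along `T_p(e)` and
  `T_p(E[p^∞]) = T_p E`);
* `charpoly_quotientTorsion_dual_eq_of_hasGoodReductionAt_of_equiv` — with the Tate-module bridge
  (p576676) and `ErratumRoadFiveSigmaLocalGoodFrobenius` §4: **`charpoly Lt = X² − (a_w/q_w)X + 1/q_w`**
  at a good `w ∤ p`;
* `eulerFactor_good_mem_span_of_equiv` — hence the membership of `hS5` (`eulerFactor_good_mem_span_of_charpoly_eq`);
* `nsmul_equiv_conjMap_eq_of_eval` — the Frobenius clause holds for any EVALUATION isomorphism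
  `e [z] = z(τ)` (Serre 1972 §1.8 Prop. 6 via `residueFieldCard_nsmul_conj_pullback_apply`, `E[p^∞]`
  unramified at `w`);
* `eulerFactor_good_mem_span_of_exists_eval` — **(S5) at the good places ⟸ «evaluation at some
  `τ ∈ I_w` is a bijection `H¹(I_w, E[p^∞]) ≃ E[p^∞]`»** (the generic local lemma (G10),
  `Hom_cont(I_F, A) ≅ A` for unramified `p`-primary `A`, `ℓ ≠ p`, typer lane).

References: [GreenbergVatsal2000] §2, Prop. 2.4 and proof (arXiv p. 22: "the eigenvalues of `Frob_ℓ` on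
`A_{I_ℓ}(−1)̂` are `ℓα_i⁻¹`"); [Skinner2016PacificMC] §2.3 (p. 180); [SerreInventiones1972] §1.8 Prop. 6;
[SilvermanAEC2009] VII.4.1, C.21 Remark 21.3.
-/

noncomputable section

open scoped Classical
open Polynomial Field NumberField IsDedekindDomain WeierstrassCurve
open Literature.NumberTheory.EllipticCurves Literature.NumberTheory.GaloisRepresentations
  Literature.NumberTheory.EllipticCurves.BigGaloisRep
  Literature.NumberTheory.GaloisRepresentations.IsNonarchimedeanLocalField
  Literature.NumberTheory.EllipticCurves.JetchevSkinnerWan2017 Literature.NumberTheory.EllipticCurves.IwasawaCharacter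

set_option autoImplicit false
-- the Theorems namespace of this sub repeats the summit name by design (D-0017 nested layout)
set_option linter.dupNamespace false

namespace Summit.BirchSwinnertonDyer.BirchSwinnertonDyer.Theorems.SigmaLocal

/-! ## §5 Assembly at a good place: from an evaluation isomorphism `H¹(I_w, E[p^∞]) ≃ E[p^∞]` -/

section Assembly

open _root_.TopRep _root_.ContinuousCohomology

variable {K : Type} [Field K] [NumberField K] (E : WeierstrassCurve K) [E.IsElliptic]
  (p : ℕ) [Fact p.Prime] {w : HeightOneSpectrum (𝓞 K)}

omit [NumberField K] [E.IsElliptic] [Fact p.Prime] in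
/-- `E[p^∞]` is `p`-primary (ℕ-scalar form). [cite: Serre1968, Ch. I §1.2] -/
theorem primaryTorsion_exists_pow_nsmul_eq_zero (a : PrimaryTorsion (geomPoints E) p) :
    ∃ k : ℕ, p ^ k • a = 0 :=
  (a.exists_pow_smul_eq_zero).imp fun k hk =>
    PrimaryTorsion.ext (by rw [PrimaryTorsion.val_nsmul, hk, PrimaryTorsion.val_zero])

omit [NumberField K] in
/-- `E[p^∞][p^k]` is finite (set form). [cite: SilvermanAEC2009, Cor. III.6.4] -/
theorem primaryTorsion_setOf_pow_nsmul_eq_zero_finite (k : ℕ) :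
    Set.Finite {a : PrimaryTorsion (geomPoints E) p | p ^ k • a = 0} := by
  haveI := E.finite_torsionBy_int_primaryTorsion p k
  have : {a : PrimaryTorsion (geomPoints E) p | p ^ k • a = 0} =
      (Submodule.torsionBy ℤ (PrimaryTorsion (geomPoints E) p) ((p ^ k : ℕ) : ℤ) : Set _) := by
    ext a
    rw [Set.mem_setOf_eq, SetLike.mem_coe, Submodule.mem_torsionBy_iff, natCast_zsmul]
  rw [this]
  exact Set.toFinite _

/-- **Transport to the Tate module (good or bad place).** Let `φ ∈ Γ_{K_w}` and let
`e : H¹(I_w, E[p^∞]) ≃ E[p^∞]` be a `ℤ_p`-linear bijection carrying `q_w •` the conjugation action of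
`φ` to `ρ(φ)`. Then `T_p` of the conjugation action has the characteristic polynomial of
`q_w⁻¹ • ρ_{E,p}(res φ)` on `T_p E` (`T_p(E[p^∞]) = T_p E`, §8 of the Tate-module bridge).
[cite: GreenbergVatsal2000, §2, proof of Prop. 2.4 (arXiv p. 22: Frob_ℓ on A_{I_ℓ}(−1))] -/
theorem charpoly_tateModule_conjMap_eq_of_equiv
    {φ : absoluteGaloisGroup (w.adicCompletion K)}
    [ContinuousSMul ℤ_[p] (PrimaryTorsion (geomPoints E) p)]
    [(absInertia (w.adicCompletion K)).Normal]
    (e : (continuousCohomology 1 (subgroupRep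
        (((E.primaryTorsionGaloisRep p).restrict (localMap K (Sum.inl w)) :
          ContinuousRep (absoluteGaloisGroup (w.adicCompletion K)) ℤ_[p]
            (PrimaryTorsion (geomPoints E) p))).toTopRep (absInertia (w.adicCompletion K)))) ≃ₗ[ℤ_[p]]
      PrimaryTorsion (geomPoints E) p)
    (he : ∀ x, residueFieldCard (w.adicCompletion K) • e ((conjMap
        (((E.primaryTorsionGaloisRep p).restrict (localMap K (Sum.inl w)) :
          ContinuousRep (absoluteGaloisGroup (w.adicCompletion K)) ℤ_[p]
            (PrimaryTorsion (geomPoints E) p))).toTopRep (absInertia (w.adicCompletion K)) φ 1).hom x) =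
      (((E.primaryTorsionGaloisRep p).restrict (localMap K (Sum.inl w)) :
          ContinuousRep (absoluteGaloisGroup (w.adicCompletion K)) ℤ_[p]
            (PrimaryTorsion (geomPoints E) p))) φ (e x))
    (n : ℤ_[p]ˣ) (hn : (n : ℤ_[p]) = residueFieldCard (w.adicCompletion K))
    [Module.Finite ℤ_[p] (TateModule (continuousCohomology 1 (subgroupRep
        (((E.primaryTorsionGaloisRep p).restrict (localMap K (Sum.inl w)) :
          ContinuousRep (absoluteGaloisGroup (w.adicCompletion K)) ℤ_[p]
            (PrimaryTorsion (geomPoints E) p))).toTopRep (absInertia (w.adicCompletion K)))) p)]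
    [Module.Free ℤ_[p] (TateModule (continuousCohomology 1 (subgroupRep
        (((E.primaryTorsionGaloisRep p).restrict (localMap K (Sum.inl w)) :
          ContinuousRep (absoluteGaloisGroup (w.adicCompletion K)) ℤ_[p]
            (PrimaryTorsion (geomPoints E) p))).toTopRep (absInertia (w.adicCompletion K)))) p)] :
    haveI := module_free_tateModule_holds E p
    haveI := module_finite_tateModule_holds E p
    (TateModule.map p (conjMap
        (((E.primaryTorsionGaloisRep p).restrict (localMap K (Sum.inl w)) :
          ContinuousRep (absoluteGaloisGroup (w.adicCompletion K)) ℤ_[p]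
            (PrimaryTorsion (geomPoints E) p))).toTopRep (absInertia (w.adicCompletion K)) φ 1).hom.toLinearMap.toAddMonoidHom).charpoly =
      ((↑n⁻¹ : ℤ_[p]) • E.galoisRepTate p (localMap K (Sum.inl w) φ)).charpoly := by
  haveI := module_free_tateModule_holds E p
  haveI := module_finite_tateModule_holds E p
  obtain ⟨e8, he8⟩ := TateModule.exists_linearEquiv_primaryTorsion (geomPoints E) p
  let Te := LinearEquiv.ofBijective (TateModule.map p e.toAddEquiv.toAddMonoidHom)
      (tateModule_map_bijective_of_addEquiv e.toAddEquiv)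
  refine charpoly_eq_charpoly_unitsInv_smul_of_nsmul_semiconj (Te.trans e8) _ _
    (residueFieldCard (w.adicCompletion K)) n hn fun t => ?_
  refine TateModule.ext fun k => ?_
  rw [map_nsmul, LinearEquiv.trans_apply, LinearEquiv.trans_apply, galoisRepTate_apply_apply,
    TateModule.proj_smul_of_distribMulAction, he8, he8]
  change residueFieldCard (w.adicCompletion K) •
      ((TateModule.proj p k (TateModule.map p e.toAddEquiv.toAddMonoidHom (TateModule.map p _ t)) :
        PrimaryTorsion (geomPoints E) p) : geomPoints E) =
    localMap K (Sum.inl w) φ •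
      ((TateModule.proj p k (TateModule.map p e.toAddEquiv.toAddMonoidHom t) :
        PrimaryTorsion (geomPoints E) p) : geomPoints E)
  rw [TateModule.proj_map, TateModule.proj_map, TateModule.proj_map, ← PrimaryTorsion.val_nsmul]
  exact congrArg PrimaryTorsion.val (he (TateModule.proj p k t))

/-- **(S5) at a GOOD place, from an evaluation isomorphism.** For `E` elliptic over a number field `K`,
`w ∤ p` of good reduction, a Frobenius `φ` of `K_w`, and ANY `ℤ_p`-linear bijection
`e : H¹(I_w, E[p^∞]) ≃ E[p^∞]` with `q_w • e(φ·x) = ρ(φ)(e x)`: the dual Frobenius `Lt` on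
`H¹(I_w, E[p^∞])^∨ ⧸ tors` has `charpoly Lt = X² − (a_w/q_w) X + 1/q_w` (`n` the unit `q_w`).
Chain: Tate-module bridge (`charpoly Lt = charpoly T_p(φ·)`), transport along `T_p(e)` and
`T_p(E[p^∞]) = T_p E`, `res φ` is an arithmetic Frobenius at `𝔓₀ ∣ w`, trace `a_w` ∕ determinant `q_w`.
[cite: GreenbergVatsal2000, §2, proof of Prop. 2.4 (arXiv p. 22: the eigenvalues of Frob_ℓ on A_{I_ℓ}(−1)̂ are ℓα_i⁻¹)]
[cite: SilvermanAEC2009, C.21 Remark 21.3] -/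
theorem charpoly_quotientTorsion_dual_eq_of_hasGoodReductionAt_of_equiv
    (hw : ((p : ℕ) : 𝓞 K) ∉ w.asIdeal) (hv : E.HasGoodReductionAt w)
    {φ : absoluteGaloisGroup (w.adicCompletion K)} (hφ : IsFrobPow φ 1)
    [ContinuousSMul ℤ_[p] (PrimaryTorsion (geomPoints E) p)]
    [(absInertia (w.adicCompletion K)).Normal]
    [Module.Finite ℤ_[p] (CharacterModule (continuousCohomology 1 (subgroupRep
        (((E.primaryTorsionGaloisRep p).restrict (localMap K (Sum.inl w)) :
          ContinuousRep (absoluteGaloisGroup (w.adicCompletion K)) ℤ_[p]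
            (PrimaryTorsion (geomPoints E) p))).toTopRep (absInertia (w.adicCompletion K)))))]
    (e : (continuousCohomology 1 (subgroupRep
        (((E.primaryTorsionGaloisRep p).restrict (localMap K (Sum.inl w)) :
          ContinuousRep (absoluteGaloisGroup (w.adicCompletion K)) ℤ_[p]
            (PrimaryTorsion (geomPoints E) p))).toTopRep (absInertia (w.adicCompletion K)))) ≃ₗ[ℤ_[p]]
      PrimaryTorsion (geomPoints E) p)
    (he : ∀ x, residueFieldCard (w.adicCompletion K) • e ((conjMap
        (((E.primaryTorsionGaloisRep p).restrict (localMap K (Sum.inl w)) :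
          ContinuousRep (absoluteGaloisGroup (w.adicCompletion K)) ℤ_[p]
            (PrimaryTorsion (geomPoints E) p))).toTopRep (absInertia (w.adicCompletion K)) φ 1).hom x) =
      (((E.primaryTorsionGaloisRep p).restrict (localMap K (Sum.inl w)) :
          ContinuousRep (absoluteGaloisGroup (w.adicCompletion K)) ℤ_[p]
            (PrimaryTorsion (geomPoints E) p))) φ (e x))
    (n : ℤ_[p]ˣ) (hn : (n : ℤ_[p]) = residueFieldCard (w.adicCompletion K))
    (Lt : (CharacterModule (continuousCohomology 1 (subgroupRep
        (((E.primaryTorsionGaloisRep p).restrict (localMap K (Sum.inl w)) :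
          ContinuousRep (absoluteGaloisGroup (w.adicCompletion K)) ℤ_[p]
            (PrimaryTorsion (geomPoints E) p))).toTopRep (absInertia (w.adicCompletion K)))) ⧸
        Submodule.torsion ℤ_[p] (CharacterModule (continuousCohomology 1 (subgroupRep
          (((E.primaryTorsionGaloisRep p).restrict (localMap K (Sum.inl w)) :
            ContinuousRep (absoluteGaloisGroup (w.adicCompletion K)) ℤ_[p]
              (PrimaryTorsion (geomPoints E) p))).toTopRep (absInertia (w.adicCompletion K)))))) →ₗ[ℤ_[p]]
      (CharacterModule (continuousCohomology 1 (subgroupRep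
        (((E.primaryTorsionGaloisRep p).restrict (localMap K (Sum.inl w)) :
          ContinuousRep (absoluteGaloisGroup (w.adicCompletion K)) ℤ_[p]
            (PrimaryTorsion (geomPoints E) p))).toTopRep (absInertia (w.adicCompletion K)))) ⧸
        Submodule.torsion ℤ_[p] (CharacterModule (continuousCohomology 1 (subgroupRep
          (((E.primaryTorsionGaloisRep p).restrict (localMap K (Sum.inl w)) :
            ContinuousRep (absoluteGaloisGroup (w.adicCompletion K)) ℤ_[p]
              (PrimaryTorsion (geomPoints E) p))).toTopRep (absInertia (w.adicCompletion K)))))))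
    (hLt : ∀ χ, Lt (Submodule.Quotient.mk χ) = Submodule.Quotient.mk
      (CharacterModule.dual (conjMap (((E.primaryTorsionGaloisRep p).restrict (localMap K (Sum.inl w)) :
          ContinuousRep (absoluteGaloisGroup (w.adicCompletion K)) ℤ_[p]
            (PrimaryTorsion (geomPoints E) p))).toTopRep (absInertia (w.adicCompletion K)) φ 1).hom.toLinearMap χ)) :
    LinearMap.charpoly Lt =
      X ^ 2 - C ((E.frobeniusTraceAt w : ℤ_[p]) * ↑n⁻¹) * X + C (↑n⁻¹ : ℤ_[p]) := by
  haveI : CompactSpace (absoluteGaloisGroup (w.adicCompletion K)) :=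
    absoluteGaloisGroup_compactSpace (w.adicCompletion K)
  haveI : CompactSpace (absInertia (w.adicCompletion K)) :=
    isCompact_iff_compactSpace.mp (isClosed_absInertia_holds (w.adicCompletion K)).isCompact
  have hA' : ∀ m : (subgroupRep (((E.primaryTorsionGaloisRep p).restrict (localMap K (Sum.inl w)) :
      ContinuousRep (absoluteGaloisGroup (w.adicCompletion K)) ℤ_[p]
        (PrimaryTorsion (geomPoints E) p))).toTopRep (absInertia (w.adicCompletion K))),
      ∃ k : ℕ, (p : ℤ_[p]) ^ k • m = 0 := fun m =>
    (primaryTorsion_exists_pow_nsmul_eq_zero E p m).imp fun k hk => by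
      rw [← Nat.cast_pow, Nat.cast_smul_eq_nsmul]; exact hk
  have hB : ∀ b : (continuousCohomology 1 (subgroupRep
      (((E.primaryTorsionGaloisRep p).restrict (localMap K (Sum.inl w)) :
        ContinuousRep (absoluteGaloisGroup (w.adicCompletion K)) ℤ_[p]
          (PrimaryTorsion (geomPoints E) p))).toTopRep (absInertia (w.adicCompletion K)))),
      ∃ k : ℕ, p ^ k • b = 0 := fun b =>
    (BigGaloisRep.exists_pow_smul_eq_zero _ (p : ℤ_[p]) hA' b).imp fun k hk => by
      rwa [← Nat.cast_pow, Nat.cast_smul_eq_nsmul] at hk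
  rw [BigRepModule.charpoly_quotientTorsion_endo_dual_eq_charpoly_tateModule_map' hB _ Lt hLt]
  haveI := TateModule.module_finite_of_module_finite_characterModule (p := p)
    (B := (continuousCohomology 1 (subgroupRep
      (((E.primaryTorsionGaloisRep p).restrict (localMap K (Sum.inl w)) :
        ContinuousRep (absoluteGaloisGroup (w.adicCompletion K)) ℤ_[p]
          (PrimaryTorsion (geomPoints E) p))).toTopRep (absInertia (w.adicCompletion K)))))
  haveI := TateModule.module_free_of_module_finite_characterModule (p := p)
    (B := (continuousCohomology 1 (subgroupRep
      (((E.primaryTorsionGaloisRep p).restrict (localMap K (Sum.inl w)) :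
        ContinuousRep (absoluteGaloisGroup (w.adicCompletion K)) ℤ_[p]
          (PrimaryTorsion (geomPoints E) p))).toTopRep (absInertia (w.adicCompletion K)))))
  have h5 := charpoly_tateModule_conjMap_eq_of_equiv E p e he n hn
  rw [h5]
  exact charpoly_unitsInv_smul_galoisRepTate_of_hasGoodReductionAt E p hw hv
    (adicCompletionPrime_mem_primesAbove K w) (isArithFrobAt_localMap_of_isFrobPow hφ) n
    (by rw [hn, residueFieldCard_eq_natCard_residueField])

/-- **(S5) at a GOOD place ⇒ the Euler-factor membership of `hS5`**, from an evaluation isomorphism: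
with `(Nw, .good a, c)` the Euler datum of `E = W ⊗ K` at `w`, `eulerFactor p ℤ_[p] Nw (.good a) c`
lies in `((charpoly Lt).reverse ((1+T)^{−c}))` (`eulerFactor_good_mem_span_of_charpoly_eq`).
[cite: GreenbergVatsal2000, Prop. 2.4 and proof (arXiv p. 22)] [cite: Skinner2016PacificMC, §2.3 (p. 180)] -/
theorem eulerFactor_good_mem_span_of_equiv
    (hw : ((p : ℕ) : 𝓞 K) ∉ w.asIdeal) (κ : ZpExtension K p) {Nw : ℕ} {a : ℤ} {c : ℤ_[p]}
    (hdata : IsEulerDataAt E κ w Nw (.good a) c)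
    {φ : absoluteGaloisGroup (w.adicCompletion K)} (hφ : IsFrobPow φ 1)
    [ContinuousSMul ℤ_[p] (PrimaryTorsion (geomPoints E) p)]
    [(absInertia (w.adicCompletion K)).Normal]
    [Module.Finite ℤ_[p] (CharacterModule (continuousCohomology 1 (subgroupRep
        (((E.primaryTorsionGaloisRep p).restrict (localMap K (Sum.inl w)) :
          ContinuousRep (absoluteGaloisGroup (w.adicCompletion K)) ℤ_[p]
            (PrimaryTorsion (geomPoints E) p))).toTopRep (absInertia (w.adicCompletion K)))))]
    (e : (continuousCohomology 1 (subgroupRep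
        (((E.primaryTorsionGaloisRep p).restrict (localMap K (Sum.inl w)) :
          ContinuousRep (absoluteGaloisGroup (w.adicCompletion K)) ℤ_[p]
            (PrimaryTorsion (geomPoints E) p))).toTopRep (absInertia (w.adicCompletion K)))) ≃ₗ[ℤ_[p]]
      PrimaryTorsion (geomPoints E) p)
    (he : ∀ x, residueFieldCard (w.adicCompletion K) • e ((conjMap
        (((E.primaryTorsionGaloisRep p).restrict (localMap K (Sum.inl w)) :
          ContinuousRep (absoluteGaloisGroup (w.adicCompletion K)) ℤ_[p]
            (PrimaryTorsion (geomPoints E) p))).toTopRep (absInertia (w.adicCompletion K)) φ 1).hom x) =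
      (((E.primaryTorsionGaloisRep p).restrict (localMap K (Sum.inl w)) :
          ContinuousRep (absoluteGaloisGroup (w.adicCompletion K)) ℤ_[p]
            (PrimaryTorsion (geomPoints E) p))) φ (e x))
    (Lt : (CharacterModule (continuousCohomology 1 (subgroupRep
        (((E.primaryTorsionGaloisRep p).restrict (localMap K (Sum.inl w)) :
          ContinuousRep (absoluteGaloisGroup (w.adicCompletion K)) ℤ_[p]
            (PrimaryTorsion (geomPoints E) p))).toTopRep (absInertia (w.adicCompletion K)))) ⧸
        Submodule.torsion ℤ_[p] (CharacterModule (continuousCohomology 1 (subgroupRep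
          (((E.primaryTorsionGaloisRep p).restrict (localMap K (Sum.inl w)) :
            ContinuousRep (absoluteGaloisGroup (w.adicCompletion K)) ℤ_[p]
              (PrimaryTorsion (geomPoints E) p))).toTopRep (absInertia (w.adicCompletion K)))))) →ₗ[ℤ_[p]]
      (CharacterModule (continuousCohomology 1 (subgroupRep
        (((E.primaryTorsionGaloisRep p).restrict (localMap K (Sum.inl w)) :
          ContinuousRep (absoluteGaloisGroup (w.adicCompletion K)) ℤ_[p]
            (PrimaryTorsion (geomPoints E) p))).toTopRep (absInertia (w.adicCompletion K)))) ⧸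
        Submodule.torsion ℤ_[p] (CharacterModule (continuousCohomology 1 (subgroupRep
          (((E.primaryTorsionGaloisRep p).restrict (localMap K (Sum.inl w)) :
            ContinuousRep (absoluteGaloisGroup (w.adicCompletion K)) ℤ_[p]
              (PrimaryTorsion (geomPoints E) p))).toTopRep (absInertia (w.adicCompletion K)))))))
    (hLt : ∀ χ, Lt (Submodule.Quotient.mk χ) = Submodule.Quotient.mk
      (CharacterModule.dual (conjMap (((E.primaryTorsionGaloisRep p).restrict (localMap K (Sum.inl w)) :
          ContinuousRep (absoluteGaloisGroup (w.adicCompletion K)) ℤ_[p]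
            (PrimaryTorsion (geomPoints E) p))).toTopRep (absInertia (w.adicCompletion K)) φ 1).hom.toLinearMap χ)) :
    eulerFactor p ℤ_[p] Nw (.good a) c ∈
      Ideal.span {Polynomial.aeval (BigRepModule.binomSeries ℤ_[p] (-c)) (LinearMap.charpoly Lt).reverse} := by
  obtain ⟨hNw, -, hv, ha⟩ := hdata
  obtain ⟨n, hn⟩ := isUnit_residueFieldCard_padicInt (K := K) (w := w) hw
  refine eulerFactor_good_mem_span_of_charpoly_eq Lt Nw a c n ?_ ?_
  · rw [hn, hNw, residueFieldCard_eq_absNorm]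
  · rw [ha]
    exact charpoly_quotientTorsion_dual_eq_of_hasGoodReductionAt_of_equiv E p hw hv hφ e he n hn Lt hLt

/-- **The Frobenius clause from an evaluation isomorphism (good place).** If `e : H¹(I_w, E[p^∞]) ≃ E[p^∞]`
is evaluation of cocycles at some `τ ∈ I_w` (`e [z] = z(τ)`), then `q_w • e(φ·x) = ρ(φ)(e x)`: at a good
`w ∤ p` the module `E[p^∞]` is unramified, so `q_w • (φ·z)(τ) = ρ(φ)(z(τ))` (Serre 1972 §1.8 Prop. 6,
`residueFieldCard_nsmul_conj_pullback_apply`). [cite: SerreInventiones1972, §1.8 Prop. 6]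
[cite: GreenbergVatsal2000, §2, proof of Prop. 2.4 (arXiv p. 22)] -/
theorem nsmul_equiv_conjMap_eq_of_eval
    (hw : ((p : ℕ) : 𝓞 K) ∉ w.asIdeal) (hv : E.HasGoodReductionAt w)
    {φ : absoluteGaloisGroup (w.adicCompletion K)} (hφ : IsFrobPow φ 1)
    [ContinuousSMul ℤ_[p] (PrimaryTorsion (geomPoints E) p)]
    [(absInertia (w.adicCompletion K)).Normal]
    (τ : absInertia (w.adicCompletion K))
    (e : (continuousCohomology 1 (subgroupRep
        (((E.primaryTorsionGaloisRep p).restrict (localMap K (Sum.inl w)) :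
          ContinuousRep (absoluteGaloisGroup (w.adicCompletion K)) ℤ_[p]
            (PrimaryTorsion (geomPoints E) p))).toTopRep (absInertia (w.adicCompletion K)))) ≃ₗ[ℤ_[p]]
      PrimaryTorsion (geomPoints E) p)
    (hev : ∀ z, e (oneCocycleClass _ z) = z.1 τ)
    (x : (continuousCohomology 1 (subgroupRep
        (((E.primaryTorsionGaloisRep p).restrict (localMap K (Sum.inl w)) :
          ContinuousRep (absoluteGaloisGroup (w.adicCompletion K)) ℤ_[p]
            (PrimaryTorsion (geomPoints E) p))).toTopRep (absInertia (w.adicCompletion K))))) :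
    residueFieldCard (w.adicCompletion K) • e ((conjMap
        (((E.primaryTorsionGaloisRep p).restrict (localMap K (Sum.inl w)) :
          ContinuousRep (absoluteGaloisGroup (w.adicCompletion K)) ℤ_[p]
            (PrimaryTorsion (geomPoints E) p))).toTopRep (absInertia (w.adicCompletion K)) φ 1).hom x) =
      (((E.primaryTorsionGaloisRep p).restrict (localMap K (Sum.inl w)) :
          ContinuousRep (absoluteGaloisGroup (w.adicCompletion K)) ℤ_[p]
            (PrimaryTorsion (geomPoints E) p))) φ (e x) := by
  obtain ⟨z, rfl⟩ := oneCocycleClass_surjective _ x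
  have h1 : (conjMap (((E.primaryTorsionGaloisRep p).restrict (localMap K (Sum.inl w)) :
      ContinuousRep (absoluteGaloisGroup (w.adicCompletion K)) ℤ_[p]
        (PrimaryTorsion (geomPoints E) p))).toTopRep (absInertia (w.adicCompletion K)) φ 1).hom
        (oneCocycleClass _ z) = _ :=
    conjMap_oneCocycleClass _ (absInertia (w.adicCompletion K)) φ z
  rw [h1, hev, hev]
  exact residueFieldCard_nsmul_conj_pullback_apply (w.adicCompletion K) _
    (w.ringChar_residueField_adicCompletion_ne hw) (primaryTorsion_exists_pow_nsmul_eq_zero E p)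
    (primaryTorsion_setOf_pow_nsmul_eq_zero_finite E p)
    (fun σ hσ a => primaryTorsionGaloisRep_localMap_eq_of_mem_absInertia E p hv hw hσ a) hφ z τ

/-- **(S5) at a GOOD place from the evaluation isomorphism (G10 shape).** If evaluation at some
`τ ∈ I_w` is a `ℤ_p`-linear bijection `H¹(I_w, E[p^∞]) ≃ E[p^∞]` (the structure of
`Hom_cont(I_w, E[p^∞]) = Hom(ℤ_p(1), E[p^∞])` at an unramified place), then the Euler-factor membership
of `hS5` holds at the good place `w`. [cite: GreenbergVatsal2000, Prop. 2.4 and proof (arXiv p. 22)]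
[cite: Skinner2016PacificMC, §2.3 (p. 180)] -/
theorem eulerFactor_good_mem_span_of_exists_eval
    (hw : ((p : ℕ) : 𝓞 K) ∉ w.asIdeal) (κ : ZpExtension K p) {Nw : ℕ} {a : ℤ} {c : ℤ_[p]}
    (hdata : IsEulerDataAt E κ w Nw (.good a) c)
    {φ : absoluteGaloisGroup (w.adicCompletion K)} (hφ : IsFrobPow φ 1)
    [ContinuousSMul ℤ_[p] (PrimaryTorsion (geomPoints E) p)]
    [(absInertia (w.adicCompletion K)).Normal]
    [Module.Finite ℤ_[p] (CharacterModule (continuousCohomology 1 (subgroupRep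
        (((E.primaryTorsionGaloisRep p).restrict (localMap K (Sum.inl w)) :
          ContinuousRep (absoluteGaloisGroup (w.adicCompletion K)) ℤ_[p]
            (PrimaryTorsion (geomPoints E) p))).toTopRep (absInertia (w.adicCompletion K)))))]
    (hG10 : ∃ (τ : absInertia (w.adicCompletion K)) (e : (continuousCohomology 1 (subgroupRep
        (((E.primaryTorsionGaloisRep p).restrict (localMap K (Sum.inl w)) :
          ContinuousRep (absoluteGaloisGroup (w.adicCompletion K)) ℤ_[p]
            (PrimaryTorsion (geomPoints E) p))).toTopRep (absInertia (w.adicCompletion K)))) ≃ₗ[ℤ_[p]]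
      PrimaryTorsion (geomPoints E) p), ∀ z, e (oneCocycleClass _ z) = z.1 τ)
    (Lt : (CharacterModule (continuousCohomology 1 (subgroupRep
        (((E.primaryTorsionGaloisRep p).restrict (localMap K (Sum.inl w)) :
          ContinuousRep (absoluteGaloisGroup (w.adicCompletion K)) ℤ_[p]
            (PrimaryTorsion (geomPoints E) p))).toTopRep (absInertia (w.adicCompletion K)))) ⧸
        Submodule.torsion ℤ_[p] (CharacterModule (continuousCohomology 1 (subgroupRep
          (((E.primaryTorsionGaloisRep p).restrict (localMap K (Sum.inl w)) :
            ContinuousRep (absoluteGaloisGroup (w.adicCompletion K)) ℤ_[p]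
              (PrimaryTorsion (geomPoints E) p))).toTopRep (absInertia (w.adicCompletion K)))))) →ₗ[ℤ_[p]]
      (CharacterModule (continuousCohomology 1 (subgroupRep
        (((E.primaryTorsionGaloisRep p).restrict (localMap K (Sum.inl w)) :
          ContinuousRep (absoluteGaloisGroup (w.adicCompletion K)) ℤ_[p]
            (PrimaryTorsion (geomPoints E) p))).toTopRep (absInertia (w.adicCompletion K)))) ⧸
        Submodule.torsion ℤ_[p] (CharacterModule (continuousCohomology 1 (subgroupRep
          (((E.primaryTorsionGaloisRep p).restrict (localMap K (Sum.inl w)) :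
            ContinuousRep (absoluteGaloisGroup (w.adicCompletion K)) ℤ_[p]
              (PrimaryTorsion (geomPoints E) p))).toTopRep (absInertia (w.adicCompletion K)))))))
    (hLt : ∀ χ, Lt (Submodule.Quotient.mk χ) = Submodule.Quotient.mk
      (CharacterModule.dual (conjMap (((E.primaryTorsionGaloisRep p).restrict (localMap K (Sum.inl w)) :
          ContinuousRep (absoluteGaloisGroup (w.adicCompletion K)) ℤ_[p]
            (PrimaryTorsion (geomPoints E) p))).toTopRep (absInertia (w.adicCompletion K)) φ 1).hom.toLinearMap χ)) :
    eulerFactor p ℤ_[p] Nw (.good a) c ∈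
      Ideal.span {Polynomial.aeval (BigRepModule.binomSeries ℤ_[p] (-c)) (LinearMap.charpoly Lt).reverse} := by
  obtain ⟨τ, e, hev⟩ := hG10
  exact eulerFactor_good_mem_span_of_equiv E p hw κ hdata hφ e
    (nsmul_equiv_conjMap_eq_of_eval E p hw hdata.2.2.1 hφ τ e hev) Lt hLt

end Assembly

end Summit.BirchSwinnertonDyer.BirchSwinnertonDyer.Theorems.SigmaLocal

end
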